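import Mathlib
import HarnessLib
import Literature.AlgebraicGeometry.Resolution.CobordantBlowupFiltration

/-!
# S1a — the REES BIGRADING `ℤ × ι` of the cobordant algebra `R^w = B[T⁻¹, fᵢ T^{wᵢ}]` of a homogeneous centre

[OURS · L1 W4.5c · lead-1 g6] — NOT a statement of the manuscript; counted 0; AI-level work, weaker than expert
review. Crux stmt-ResolutionOfSingularities-17941 (`WildQuotients.CyclicQuotientFourfolds`), line `s1a-logminvertex`,
stub `stub_localGame` (producer), H3 `ChartClause` of `…S1aProducerStep` («the grading IS the Rees bigrading
`b' T^{d'} ↦ (d', deg b')`»): for `B` graded by `𝒜 : ι → AddSubgroup B` and a centre `(f, w)` with `fᵢ ∈ 𝒜 (δ i)`,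
Literatureʼs full cobordant blow-up algebra `cobordantAlgebra f w ⊆ B[T;T⁻¹]` ([cite: Wlodarczyk2022, Def. 2.3.5];
`= ⊕ₙ 𝒥ₙ Tⁿ`, `cobordantAlgebra_eq_extendedRees`) is BIGRADED by `ℤ × ι`:
* `reesPiece 𝒜 f w (n, i)` — the elements `x Tⁿ` of `R^w` with `x ∈ 𝒜 i`;
* `reesPiece_gradedMonoid`; the pins `mk_mem_reesPiece` (`⟨C x * T n, _⟩ ∈ piece (n, i)`), `algebraMap_mem_reesPiece`,
  `s_mem_reesPiece` (`T⁻¹ ∈ piece (-1, 0)`), `u'_mem_reesPiece` (`fᵢ T^{wᵢ} ∈ piece (wᵢ, δ i)`);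
* `isHomogeneous_weightedFiltration` — the pieces `𝒥ₙ` of the weighted filtration of a HOMOGENEOUS centre are
  homogeneous ideals (Mathlib `Ideal.homogeneous_span`), so the homogeneous components of a coefficient of an element
  of `R^w` give elements of `R^w` (`C_mul_T_decompose_mem`);
* `iSup_reesPiece_eq_top` (write `p = Σₙ C(coeff p n) Tⁿ` and decompose each coefficient), `iSupIndep_reesPiece`
  (the functional `p ↦ (coeff p n)ᵢ` kills every other piece), `isInternal_reesPiece`, and the **`GradedRing`**
  structure `reesGradedRing 𝒜 f δ w hf`.
Combined with `…S1aGradedLocalization` (`locGradedRing`) this grades every chart ring `R^w[h⁻¹]` at a bihomogeneous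
`h`, in particular H4aʼs `CoarseChart.ChartRing` (file `…S1aChartRingGrading`).
-/

set_option linter.dupNamespace false

noncomputable section

open DirectSum Literature.AlgebraicGeometry.Resolution
open scoped LaurentPolynomial

namespace Summit.ResolutionOfSingularities.ResolutionOfSingularities.Theorems.WildQuotientResolution.S1.ReesBigrading

universe u v

/-! ## Laurent-polynomial bookkeeping -/

section Laurent

variable {B : Type u} [CommRing B]

/-- Coefficients of `C x · Tⁿ`. -/
theorem coeff_C_mul_T (x : B) (n m : ℤ) :
    (LaurentPolynomial.C x * LaurentPolynomial.T n : B[T;T⁻¹]).coeff m = if n = m then x else 0 := by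
  rw [← LaurentPolynomial.single_eq_C_mul_T, AddMonoidAlgebra.coeff_single, Finsupp.single_apply]

/-- Every Laurent polynomial is the sum of its monomials `C (coeff p n) · Tⁿ`. -/
theorem eq_sum_C_mul_T (p : B[T;T⁻¹]) :
    p = ∑ n ∈ p.coeff.support, LaurentPolynomial.C (p.coeff n) * LaurentPolynomial.T n := by
  apply AddMonoidAlgebra.coeff_injective
  rw [AddMonoidAlgebra.coeff_sum]
  simp_rw [← LaurentPolynomial.single_eq_C_mul_T, AddMonoidAlgebra.coeff_single]
  exact (Finsupp.sum_single p.coeff).symm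

end Laurent

section Bigrading

variable {ι : Type v} {B : Type u} [CommRing B]
  (𝒜 : ι → AddSubgroup B) {c : ℕ} (f : Fin c → B) (δ : Fin c → ι) (w : Fin c → ℕ)

/-! ## Membership of monomials in `R^w` -/

/-- `C x · Tⁿ ∈ R^w` iff `x` satisfies the coefficient condition of degree `n` (`x ∈ 𝒥ₙ` for `n ≥ 0`, nothing for
`n < 0`). -/
theorem C_mul_T_mem_iff {x : B} {n : ℤ} :
    LaurentPolynomial.C x * LaurentPolynomial.T n ∈ cobordantAlgebra f w ↔ (weightedFiltration f w).CoeffMem n x := by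
  rw [cobordantAlgebra_eq_extendedRees]
  change (∀ m : ℤ, (weightedFiltration f w).CoeffMem m ((LaurentPolynomial.C x * LaurentPolynomial.T n).coeff m)) ↔ _
  constructor
  · intro h
    have := h n
    rwa [coeff_C_mul_T, if_pos rfl] at this
  · intro h m
    rw [coeff_C_mul_T]
    split_ifs with hnm
    · subst hnm; exact h
    · exact IdealFiltration.coeffMem_zero m

/-- The coefficients of an element of `R^w` satisfy the coefficient conditions. -/
theorem coeffMem_coeff (p : ↥(cobordantAlgebra f w)) (m : ℤ) :
    (weightedFiltration f w).CoeffMem m ((p : B[T;T⁻¹]).coeff m) := by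
  have hp : (p : B[T;T⁻¹]) ∈ (weightedFiltration f w).extendedRees := by
    rw [← cobordantAlgebra_eq_extendedRees]; exact p.2
  exact hp m

/-! ## The pieces -/

/-- **The Rees bigrading**: the piece of bidegree `(n, i)` consists of the `x Tⁿ ∈ R^w` with `x ∈ 𝒜 i`.
[OURS · L1 W4.5c] -/
def reesPiece (ni : ℤ × ι) : AddSubgroup ↥(cobordantAlgebra f w) where
  carrier := {p | ∃ x : B, x ∈ 𝒜 ni.2 ∧
    ((p : ↥(cobordantAlgebra f w)) : B[T;T⁻¹]) = LaurentPolynomial.C x * LaurentPolynomial.T ni.1}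
  zero_mem' := ⟨0, zero_mem _, by rw [ZeroMemClass.coe_zero, map_zero, zero_mul]⟩
  add_mem' := by
    rintro p q ⟨x, hx, hp⟩ ⟨y, hy, hq⟩
    exact ⟨x + y, add_mem hx hy, by rw [AddMemClass.coe_add, hp, hq, map_add, add_mul]⟩
  neg_mem' := by
    rintro p ⟨x, hx, hp⟩
    exact ⟨-x, neg_mem hx, by rw [NegMemClass.coe_neg, hp, map_neg, neg_mul]⟩

/-- Normal form of the elements of a piece. -/
theorem mem_reesPiece_iff {ni : ℤ × ι} {p : ↥(cobordantAlgebra f w)} :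
    p ∈ reesPiece 𝒜 f w ni ↔ ∃ x : B, x ∈ 𝒜 ni.2 ∧
      ((p : ↥(cobordantAlgebra f w)) : B[T;T⁻¹]) = LaurentPolynomial.C x * LaurentPolynomial.T ni.1 :=
  Iff.rfl

/-- PIN: `x Tⁿ` (known to lie in `R^w`) has bidegree `(n, deg x)`. -/
theorem mk_mem_reesPiece {x : B} {n : ℤ} {i : ι} (hx : x ∈ 𝒜 i)
    (hmem : LaurentPolynomial.C x * LaurentPolynomial.T n ∈ cobordantAlgebra f w) :
    (⟨_, hmem⟩ : ↥(cobordantAlgebra f w)) ∈ reesPiece 𝒜 f w (n, i) :=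
  ⟨x, hx, rfl⟩

/-- PIN: the structure map `B → R^w` has bidegree `(0, ·)`. -/
theorem algebraMap_mem_reesPiece {x : B} {i : ι} (hx : x ∈ 𝒜 i) :
    algebraMap B ↥(cobordantAlgebra f w) x ∈ reesPiece 𝒜 f w (0, i) :=
  ⟨x, hx, by rw [cobordantAlgebra.coe_algebraMap, LaurentPolynomial.T_zero, mul_one]⟩

variable {δ} in
/-- PIN: `fᵢ T^{wᵢ}` has bidegree `(wᵢ, δ i)`. -/
theorem u'_mem_reesPiece (hf : ∀ i, f i ∈ 𝒜 (δ i)) (i : Fin c) :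
    cobordantAlgebra.u' f w i ∈ reesPiece 𝒜 f w ((w i : ℤ), δ i) :=
  ⟨f i, hf i, rfl⟩

variable [AddCommGroup ι] [DecidableEq ι] [GradedRing 𝒜]

/-- PIN: `s = T⁻¹` has bidegree `(-1, 0)`. -/
theorem s_mem_reesPiece : cobordantAlgebra.s f w ∈ reesPiece 𝒜 f w (-1, 0) :=
  ⟨1, SetLike.one_mem_graded 𝒜, by rw [cobordantAlgebra.coe_s, map_one, one_mul]⟩

/-- The pieces form a graded monoid. -/
theorem reesPiece_gradedMonoid : SetLike.GradedMonoid (reesPiece 𝒜 f w) where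
  one_mem := ⟨1, SetLike.one_mem_graded 𝒜, by
    rw [OneMemClass.coe_one, map_one, one_mul, Prod.fst_zero, LaurentPolynomial.T_zero]⟩
  mul_mem := by
    rintro ⟨n, i⟩ ⟨m, j⟩ p q ⟨x, hx, hp⟩ ⟨y, hy, hq⟩
    refine ⟨x * y, SetLike.mul_mem_graded hx hy, ?_⟩
    rw [MulMemClass.coe_mul, hp, hq, Prod.fst_add, map_mul, LaurentPolynomial.T_add]
    ring

/-! ## Homogeneity of the weighted filtration -/

variable {δ}

/-- The weighted monomials of a homogeneous centre are homogeneous. -/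
theorem isHomogeneousElem_of_mem_weightedMonomials (hf : ∀ i, f i ∈ 𝒜 (δ i)) {n : ℕ} {m : B}
    (hm : m ∈ weightedMonomials f w n) : SetLike.IsHomogeneousElem 𝒜 m := by
  obtain ⟨α, -, rfl⟩ := hm
  exact ⟨∑ i ∈ α.support, α i • δ i, SetLike.prod_pow_mem_graded 𝒜 δ f α fun i _ => hf i⟩

/-- **The pieces `𝒥ₙ` of the weighted filtration of a homogeneous centre are homogeneous ideals.** -/
theorem isHomogeneous_weightedFiltration (hf : ∀ i, f i ∈ 𝒜 (δ i)) (n : ℕ) :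
    ((weightedFiltration f w).ideal n).IsHomogeneous 𝒜 := by
  rw [weightedFiltration_ideal]
  exact Ideal.homogeneous_span 𝒜 _ fun m hm => isHomogeneousElem_of_mem_weightedMonomials 𝒜 f w hf hm

/-- Homogeneous components preserve the coefficient conditions. -/
theorem coeffMem_decompose (hf : ∀ i, f i ∈ 𝒜 (δ i)) {m : ℤ} {x : B} (hx : (weightedFiltration f w).CoeffMem m x)
    (i : ι) : (weightedFiltration f w).CoeffMem m (DirectSum.decompose 𝒜 x i : B) :=
  fun n hn => isHomogeneous_weightedFiltration 𝒜 f w hf n i (hx n hn)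

/-- Hence the homogeneous components of a monomial of `R^w` lie in `R^w`. -/
theorem C_decompose_mul_T_mem (hf : ∀ i, f i ∈ 𝒜 (δ i)) (p : ↥(cobordantAlgebra f w)) (n : ℤ) (i : ι) :
    LaurentPolynomial.C (DirectSum.decompose 𝒜 ((p : B[T;T⁻¹]).coeff n) i : B) * LaurentPolynomial.T n ∈
      cobordantAlgebra f w :=
  (C_mul_T_mem_iff f w).mpr (coeffMem_decompose 𝒜 f w hf (coeffMem_coeff f w p n) i)

/-! ## Internality -/

/-- **The pieces span `R^w`.** -/
theorem iSup_reesPiece_eq_top (hf : ∀ i, f i ∈ 𝒜 (δ i)) : ⨆ ni, reesPiece 𝒜 f w ni = ⊤ := by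
  classical
  rw [eq_top_iff]
  rintro p -
  -- `p = Σₙ Σᵢ (coeff p n)ᵢ Tⁿ`, each summand in `R^w` and in the piece `(n, i)`
  have hp : p = ∑ n ∈ (p : B[T;T⁻¹]).coeff.support,
      ∑ i ∈ (DirectSum.decompose 𝒜 ((p : B[T;T⁻¹]).coeff n)).support,
        (⟨_, C_decompose_mul_T_mem 𝒜 f w hf p n i⟩ : ↥(cobordantAlgebra f w)) := by
    refine Subtype.ext ?_
    rw [AddSubmonoidClass.coe_finsetSum]
    conv_lhs => rw [eq_sum_C_mul_T (p : B[T;T⁻¹])]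
    refine Finset.sum_congr rfl fun n _ => ?_
    rw [AddSubmonoidClass.coe_finsetSum]
    simp only
    rw [← Finset.sum_mul, ← map_sum, DirectSum.sum_support_decompose 𝒜]
  rw [hp]
  refine AddSubgroup.sum_mem _ fun n _ => AddSubgroup.sum_mem _ fun i _ =>
    AddSubgroup.mem_iSup_of_mem (n, i) ?_
  exact ⟨_, (DirectSum.decompose 𝒜 _ i).2, rfl⟩

/-- The functional `p ↦ ((coeff p n)ᵢ : B)` reading the bidegree-`(n, i)` component. -/
def component (n : ℤ) (i : ι) : ↥(cobordantAlgebra f w) →+ B where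
  toFun p := (DirectSum.decompose 𝒜 ((p : B[T;T⁻¹]).coeff n) i : B)
  map_zero' := by simp
  map_add' p q := by
    simp only [AddMemClass.coe_add, AddMonoidAlgebra.coeff_add, Finsupp.add_apply, DirectSum.decompose_add,
      DirectSum.add_apply]

/-- The functional of bidegree `(n, i)` kills every other piece. -/
theorem component_eq_zero_of_mem {n : ℤ} {i : ι} {nj : ℤ × ι} (hne : nj ≠ (n, i)) {p : ↥(cobordantAlgebra f w)}
    (hp : p ∈ reesPiece 𝒜 f w nj) : component 𝒜 f w n i p = 0 := by
  obtain ⟨x, hx, hpx⟩ := hp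
  change (DirectSum.decompose 𝒜 ((p : B[T;T⁻¹]).coeff n) i : B) = 0
  rw [hpx, coeff_C_mul_T]
  split_ifs with h
  · refine DirectSum.decompose_of_mem_ne 𝒜 hx fun h' => hne ?_
    ext <;> simp [h, h']
  · simp

/-- On its own piece the functional recovers the coefficient. -/
theorem component_eq_of_mem {n : ℤ} {i : ι} {p : ↥(cobordantAlgebra f w)} {x : B} (hx : x ∈ 𝒜 i)
    (hpx : ((p : ↥(cobordantAlgebra f w)) : B[T;T⁻¹]) = LaurentPolynomial.C x * LaurentPolynomial.T n) :
    component 𝒜 f w n i p = x := by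
  change (DirectSum.decompose 𝒜 ((p : B[T;T⁻¹]).coeff n) i : B) = x
  rw [hpx, coeff_C_mul_T, if_pos rfl, DirectSum.decompose_of_mem_same 𝒜 hx]

/-- **The pieces are independent.** -/
theorem iSupIndep_reesPiece : iSupIndep (reesPiece 𝒜 f w) := by
  classical
  rintro ⟨n, i⟩
  rw [disjoint_iff_inf_le]
  rintro p ⟨hp₁, hp₂⟩
  have h0 : component 𝒜 f w n i p = 0 := by
    refine AddSubgroup.iSup_induction (fun nj => ⨆ (_ : nj ≠ (n, i)), reesPiece 𝒜 f w nj)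
      (C := fun q => component 𝒜 f w n i q = 0) hp₂ ?_ (map_zero _) ?_
    · intro nj q hq
      by_cases hnj : nj = (n, i)
      · subst hnj
        rw [iSup_neg (fun h => h rfl), AddSubgroup.mem_bot] at hq
        rw [hq, map_zero]
      · rw [iSup_pos hnj] at hq
        exact component_eq_zero_of_mem 𝒜 f w hnj hq
    · intro q₁ q₂ h₁ h₂
      rw [map_add, h₁, h₂, add_zero]
  obtain ⟨x, hx, hpx⟩ := hp₁
  rw [component_eq_of_mem 𝒜 f w hx hpx] at h0
  rw [AddSubgroup.mem_bot]
  exact Subtype.ext (by rw [hpx, h0, map_zero, zero_mul, ZeroMemClass.coe_zero])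

/-- The decomposition is internal. -/
theorem isInternal_reesPiece (hf : ∀ i, f i ∈ 𝒜 (δ i)) : DirectSum.IsInternal (reesPiece 𝒜 f w) := by
  classical
  refine ⟨(iSupIndep_reesPiece 𝒜 f w).dfinsuppSumAddHom_injective, fun p => ?_⟩
  have hp : p ∈ ⨆ ni, reesPiece 𝒜 f w ni := by rw [iSup_reesPiece_eq_top 𝒜 f w hf]; trivial
  refine AddSubgroup.iSup_induction (reesPiece 𝒜 f w)
    (C := fun y => ∃ z, DirectSum.coeAddMonoidHom (reesPiece 𝒜 f w) z = y) hp
    (fun e y hy => ⟨DirectSum.of (fun ni => ↥(reesPiece 𝒜 f w ni)) e ⟨y, hy⟩,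
      DirectSum.coeAddMonoidHom_of (reesPiece 𝒜 f w) _ _⟩)
    ⟨0, (DirectSum.coeAddMonoidHom (reesPiece 𝒜 f w)).map_zero⟩ ?_
  rintro _ _ ⟨z₁, rfl⟩ ⟨z₂, rfl⟩
  exact ⟨z₁ + z₂, (DirectSum.coeAddMonoidHom (reesPiece 𝒜 f w)).map_add z₁ z₂⟩

/-- **The cobordant algebra of a homogeneous centre is a `ℤ × ι`-graded ring.** [OURS · L1 W4.5c] -/
@[implicit_reducible]
def reesGradedRing (hf : ∀ i, f i ∈ 𝒜 (δ i)) : GradedRing (reesPiece 𝒜 f w) :=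
  { reesPiece_gradedMonoid 𝒜 f w with
    toDecomposition := (isInternal_reesPiece 𝒜 f w hf).chooseDecomposition }

end Bigrading

end Summit.ResolutionOfSingularities.ResolutionOfSingularities.Theorems.WildQuotientResolution.S1.ReesBigrading

end
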